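import Summits.QuantumFields.YangMills.Theorems.BalabanUVNodesK0AxGaugeFlowRecDefs
import Summits.QuantumFields.YangMills.Theorems.BalabanUVNodesK0RecordFormatNamesLocE

/-!
# K0⁷ — THE RECORD-SIDE FORMAT NAMES, EDITION 20 = THE LEG-DRESSED ROOTED CHART (road (R-a), ◆ CRIT-1 g36 CUT PASS + rider (r1), nodeO STATUS 2026-08-31T09:08:18Z, (ra-2)):
# `recordDressPot ∕ recordEmbJDressed` and the displayed link identity `DressLink`

Cell `ym-nodeO-ideate` ∕ `ym-balaban-port`, DEFINER seat `ym-nodeO-def-1` (gen 36); `--kind definition --supports stmt-QuantumFields-20541 --as helper`; count-neutral.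
[I] = [Balaban1987RG1], [15] = [Balaban1985Variational], [B6] = [Balaban1984PropagatorsII].

WHY — ROAD (R-a) «MOVE THE CHART, NOT THE LETTERS» (DEF-1 g36 l.4975; ◆ CRIT-1 g36 cut l.4985: PASS, supersedes (W2-3)).  JOIN-T's k-step ✓ `K0AxJoinT.twoVol_pvolOf_of_rows_trace` is parametric in the
chart `ιe`, the response letter `Gc` and the data `R`; its decay rows (R1ᴰ)∕(R4ᴰ) are statements in the (4.4)-domain gauge, which is NOT blind to gradient legs.  At the ROOTED chart `recordEmbJ` the response
`recordGkJ` agrees with the WINDOW letter `recordGkLocWξ … Finset.univ` only MODULO a gradient leg (`TableRowLT` + `landauRepC_eq_sub_grad`, legal bridges); at the CENTRED AXIAL chart `recordEmbJC` (ed.19) the response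
`recordGkJC` is not (4.4)-regular (DEF-1 g36 W2-4 toy: ratios `(L, L², L³)` in the three clauses).  So instead of transferring decay between representatives, DRESS THE ROOTED CHART by the gauge flow of the leg: the
dressed chart's first-order response IS the window letter, whose `Response9D` receipt `Response9DAtLocUnivξ` (ed.17) is ✓ ⟸ (Tok-cmpU-cap) in the tree (★ PTB-1 `portPieceLocalityU8_LocUniv_of_cmp`), and the pieces see
no difference because (GI) removes gauge flows EXACTLY.  THIS FILE names the dressed chart (◆'s (ra-2) literal) and the displayed link identity (rider (r1)): the potential family `φ′` is an explicit PARAMETER and the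
identity «`recordGkJ + recordGradLeg (φ′ l a) = recordGkLocWξ univ`» is a displayed HYPOTHESIS (`DressLink`) — no `Classical.choose`, the definition is total and junk-free; (C-tab-opt) ∕ P0 stay displayed where they belong.

WHAT THIS FILE IS (definitions only; statement-form; NEW names; every earlier object untouched — append-only rule):
* §26e `recordDressPot F θ k K φ′ B : Site (F.P K) 0 → Fin 3 → ℂ` — the B-LINEAR gauge potential `Σ_{l,a} B^a_l · φ′ l a` (`B^a_l := θ.bV.repr (B l.1 l.2) a`, the `bV`-coordinate functional).
* §26e ★ `recordEmbJDressed F θ k K φ′ B := gaugeFlowMap F K (expGauge F K (recordDressPot … φ′ B) 1) (recordEmbJ F θ k K B)` — ★ PTB-1∕◇ lens-1's chart-level gauge flow (✓ `K0AxGaugeFlowRec.gaugeFlowMap ∕ expGauge`,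
  p813155) of the ROOTED two-block chart by the potential `recordDressPot φ′ B` — the ONE chart JOIN-T's k-step is to be instantiated at under (R-a) (`ιe n := recordEmbJDressed … (K₀+n) φ′`).
* §26e receipt ★ `DressLink F θ k K φ′ : Prop` := `∀ a l i, recordGkJ … a l i + recordGradLeg F K (φ′ l a) i = recordGkLocWξ … Finset.univ a l i` — rider (r1)'s displayed identity (⟸ `TableRowLT` + bk-1 mod
  (C-tab-opt)∕P0 — the link lemma (ra-3) takes it as a hypothesis; asserted for nothing here).

NOT HERE (lens-1 g10's W2 file ∕ PTC-1): (ra-1) `formatPlusG_gaugeDressed`, (ra-3) `recordEmbJDressed_zero ∕ _contDiffAt ∕ fderiv_recordEmbJDressed`, (ra-4) `flipLocUnivξ ∕ response9D_flipLocUnivξ ∕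
recordTwoVol_of_rows_LocUnivξ ∕ kstep_joinT_at_record_dressed` — theorems over these names.

HONEST FRAMING.  Definitions only; NOTHING of Bałaban is asserted, ported or discharged; `DressLink` is DISPLAYED (its suppliers (C-tab-opt) mod P0 and `TableRowLT` are OPEN∕displayed rows); D1 = 27930's
consequent, (Tok-cmpU-cap), HypAn, ⟨26900⟩ OPEN; [E] inhabited unconditionally NOWHERE; 27931 CLOSED·IMPLICATION-ONLY·IN TOTO; 27930 ∕ 26648 OPEN; K0ᴬ ∕ K1ᴬ ∕ K3ᴬ OPEN; NODE O not inhabited (0∕1); COUNT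
8∕28 · K 1∕4 UNMOVED; finite `𝕋⁴_{L^K}` at fixed ε — NOT continuum ∕ ℝ⁴ ∕ OS; **the Yang–Mills mass gap (Clay) is NOT proved by any of this.**  No `sorry`, `instance`, `notation`; standard axioms.
-/

noncomputable section

open scoped BigOperators Matrix.Norms.L2Operator

namespace Summit.QuantumFields.YangMills.Theorems.K0RecordFormatNames

open Literature.MathematicalPhysics.QuantumFieldTheory.Balaban1983to89
open Literature.MathematicalPhysics.QuantumFieldTheory.Balaban1983to89.Node00
open Literature.MathematicalPhysics.QuantumFieldTheory.Balaban1983to89.T4Continuum (T4Family)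
open Summit.QuantumFields.YangMills.Theorems.K0AxGaugeFlowRec (gaugeFlowMap expGauge recordGradLeg)

variable (F : T4Family)

section Theta

variable (θ : Stage13Params F 2)

/-! ## §26e  The leg-dressed rooted chart (road (R-a)) and its displayed link identity -/

/-- **`recordDressPot F θ k K φ′ B`** — the B-LINEAR GAUGE POTENTIAL `x ↦ Σ_{l : RespLabel} Σ_{a : ιβ} B^a_l · φ′ l a x` with `B^a_l := θ.bV.repr (B l.1 l.2) a` (the `bV`-coordinates of the datum at the label `l`);
`φ′ l a : Site (F.P K) 0 → Fin 3 → ℂ` is the leg potential for the basis field `δ_l ⊗ bV a` — an explicit PARAMETER (rider (r1): no choice inside the definition).  Linear in `B`, `0` at `B = 0`.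
[cite: Balaban1987RG1, (1.10) p.262, (4.8) p.283 (bookkeeping)] -/
def recordDressPot (k K : ℕ) (φ' : RespLabel F k K → θ.ιβ → Site (F.P K) 0 → Fin 3 → ℂ) (B : Fin (F.P K).d → Site (F.P K) (k + 1) → θ.Vβ) :
    Site (F.P K) 0 → Fin 3 → ℂ :=
  letI := θ.instVβ₁; letI := θ.instVβ₂; letI := θ.instιβ
  fun x c => ∑ l : RespLabel F k K, ∑ a : θ.ιβ, ((θ.bV.repr (B l.1 l.2) a : ℝ) : ℂ) * φ' l a x c

/-- ★ **THE LEG-DRESSED ROOTED CHART `ι♮` — `recordEmbJDressed F θ k K φ′ B := gaugeFlowMap F K (expGauge F K (recordDressPot … φ′ B) 1) (recordEmbJ F θ k K B)`**: the rooted two-block chart `recordEmbJ` moved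
along the (1.10) gauge action (`K0AxGaugeFlowRec.gaugeFlowMap`, coordinates of `(u₋𝐔u₊⁻¹, u₋𝐉u₋⁻¹)`) by the `SL(2,ℂ)`-valued lattice gauge map `expGauge … (recordDressPot φ′ B) 1 = exp(gaugeGen (Σ B^a_l φ′ l a))`.  ROAD
(R-a): with `φ′` supplied by the legal mod-gradient bridge (`DressLink` below), the first-order response of `ι♮` at `B = 0` IS the window letter `recordGkLocWξ … Finset.univ` (link lemma (ra-3), elsewhere), the pieces
are blind to the dressing ((GI): `E_X (act g u) = E_X u` exactly), and JOIN-T's decay rows read ed.17's `Response9DAtLocUnivξ`.  A NAME; nothing asserted. [cite: Balaban1987RG1, (1.10) p.262, (4.8) p.283, (4.35) p.290; Balaban1984PropagatorsII, (2.35) p.228] -/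
def recordEmbJDressed (k K : ℕ) (φ' : RespLabel F k K → θ.ιβ → Site (F.P K) 0 → Fin 3 → ℂ) (B : Fin (F.P K).d → Site (F.P K) (k + 1) → θ.Vβ) :
    Fin (recordChartDimJ F K) → ℂ :=
  gaugeFlowMap F K (expGauge F K (recordDressPot F θ k K φ' B) 1) (recordEmbJ F θ k K B)

/-- ★ **RECEIPT `DressLink F θ k K φ′`** (rider (r1), DISPLAYED — asserted for nothing): the potential family `φ′` REALISES THE LEGAL BRIDGE at every basis field — the rooted two-block response plus the gradient leg
of `φ′ l a` IS the whole-torus window response: `∀ a l i, recordGkJ … a l i + recordGradLeg F K (φ′ l a) i = recordGkLocWξ … Finset.univ a l i`.  Suppliers (OPEN ∕ displayed): `K0AxRowLTRec.TableRowLT` (⟸ (C-tab-opt)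
mod P0, ✓ `tableRowLT_of_weaklyCritical`) moved from `recordGkL` to `recordGkJ` by ✓ `K0AxCtabUniq.landauRepC_eq_sub_grad`; it is the hypothesis under which the link lemma `fderiv (recordEmbJDressed … φ′) 0 (δ_l ⊗ bV a)
= recordGkLocWξ univ a l` holds.  J5′: an identity modulo a gradient leg between the rooted response and a WINDOW letter — legal; no decay of a rooted representative is displayed anywhere.
[cite: Balaban1987RG1, (4.35) p.290, (1.10) p.262; Balaban1985Variational, Prop. 9 p.309, (178) p.306; Balaban1984PropagatorsII, (2.35) p.228] -/
def DressLink (k K : ℕ) (φ' : RespLabel F k K → θ.ιβ → Site (F.P K) 0 → Fin 3 → ℂ) : Prop :=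
  ∀ (a : θ.ιβ) (l : RespLabel F k K) (i : Fin (recordChartDimJ F K)),
    recordGkJ F θ k K a l i + recordGradLeg F K (φ' l a) i = recordGkLocWξ F θ k K Finset.univ a l i

/-- FACE (by `rfl`): the dressed chart unfolded — for consumers that state rows over `gaugeFlowMap ∕ expGauge` directly. [cite: Balaban1987RG1, (1.10) p.262 (bookkeeping)] -/
theorem recordEmbJDressed_eq (k K : ℕ) (φ' : RespLabel F k K → θ.ιβ → Site (F.P K) 0 → Fin 3 → ℂ) (B : Fin (F.P K).d → Site (F.P K) (k + 1) → θ.Vβ) :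
    recordEmbJDressed F θ k K φ' B = gaugeFlowMap F K (expGauge F K (recordDressPot F θ k K φ' B) 1) (recordEmbJ F θ k K B) := rfl

end Theta

end Summit.QuantumFields.YangMills.Theorems.K0RecordFormatNames

end
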